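import Summits.QuantumFields.BalabanUV.T4Continuum.Support.NE7SliceIterationContractionArith
import HarnessLib

/-!
# NE7SliceIterationContractionArithNL — THE CONTRACTION ARITHMETIC ON THE NONLINEAR FRAME TARGET (memo ROAD-G103 §3, (R1′), file (B2)-4): the three floors of
# `NE7SliceIterationContractionArith` (`e_E`, `2KM·c_E`, `e_c∕M`) re-derived with the EFFECTIVE corner junk `ẽ_c = e_c + E`, `E := 4·G·M²·b₁·(Df + e_J)` (`G = C_Γ`, `b₁` the regime radius),
# in the enlarged currency `τ + ω`, `ω ≥ 4G·(M·b₁)`: `E∕M ≤ 2ω·Df`, `ẽ_c∕M ≤ 24576d(τ+ω)Df`, `ẽ_E ≤ 10⁶(1+supC)d²(τ+ω)Df`, `2KM·c̃_E ≤ 2·10⁶K(1+supCurlC)d²(τ+ω)Df` — so that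
# `step_bound_le_half` applies VERBATIM at `τ + ω` and the NL step halves the defect under `3·10⁶(1+16K)(1+d)³(1+frameC)(1+supC+supCurlC)·(τ+ω) ≤ 1∕2`

Cell `pub-balaban`, rung (B)+1 sub-cell t4, lineage `b2b-balaban-t4-ne7-p1`, generation 103 (CRUX PROVER NE7 #1 = OWNER of BINDER row NE7).  Memo `t4/b2b-balaban-t4-ne7-p1-g103/ROAD-G103.md` §3.
Pure real arithmetic; `ω` is the new k-free smallness currency «frame-defect Lipschitz constant × regime radius in `M`-units» (`ω = 4C_Γ·M·b₁ = O(C_Γ·C_S·ε)`).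
WHAT ([folklore]; 0 def, 0 sorry).  `EM_le`, `ecM_le_nl`, `extra_eE_le`, `extra_cE_le`, `eE_le_nl`, `twoKM_cE_le_nl`.
HONEST FRAMING (page 1): arithmetic only; nothing of Bałaban's asserted; NOT the orbit, NOT (S1), NOT NE7; spine 0∕9; finite T⁴ rung (B)+1 — NOT infinite volume, NOT mass gap, NOT BetaPertH, NOT Clay.
Continuum YM on T⁴ ⇐ BetaPertH ∧ nine spine estimates (0/9 proved); BetaPertH ⇐ (D1) ∧ (D4) ∧ CAP+tail; G-an2-4 gates asym, D1 and NE2/3/4.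
-/

set_option autoImplicit false

namespace Summit.QuantumFields.BalabanUV.T4Continuum.NE7SliceIterationContractionArithNL

open NE7SliceIterationContractionArith (eJ_le ecM_le eE_le twoKM_cE_le)

section Arith

variable {dd M K sC sCC s η D x x' θc τ G b₁ ω : ℝ}
  (hdd : 1 ≤ dd) (hM : 1 ≤ M) (hK : 0 ≤ K) (hsC : 0 ≤ sC) (hsCC : 0 ≤ sCC)
  (hs : 0 ≤ s) (hη : 0 ≤ η) (hD : 0 ≤ D) (hθc : θc ≤ 1 / 2) (hτ0 : 0 ≤ τ)
  (h1 : M * s ≤ τ) (h2 : M * D ≤ τ) (h3 : η ≤ τ) (h4 : M ^ 2 * x ≤ τ) (h5 : M ^ 2 * x' ≤ τ) (hτs : 30000 * dd * τ ≤ 1)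
  (hG : 0 ≤ G) (hb₁ : 0 ≤ b₁) (hω0 : 0 ≤ ω) (hβ : 4 * G * (M * b₁) ≤ ω)

include hdd hM hs hD hτ0 h1 h2 hτs hω0 hβ in
/-- **`E∕M ≤ 2ω·Df`** for `E := 4G·M²·b₁·(Df + e_J)` (`E∕M = 4G·(Mb₁)·(Df + e_J) ≤ ω·2Df`, since `e_J ≤ 30000dτ·Df ≤ Df`). [folklore] -/
theorem EM_le : 4 * G * M ^ 2 * b₁ * (D + (16384 * D * s + 2048 * (6 * dd * M * D) * D + 6 * (6 * dd * M * D) * s)) / M ≤ 2 * ω * D := by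
  have hM0 : 0 < M := by linarith
  have hJ := eJ_le hdd hM hs hD hτ0 h1 h2
  have heJD : 16384 * D * s + 2048 * (6 * dd * M * D) * D + 6 * (6 * dd * M * D) * s ≤ D := hJ.trans (by nlinarith [mul_le_mul_of_nonneg_right hτs hD])
  have heJ0 : 0 ≤ 16384 * D * s + 2048 * (6 * dd * M * D) * D + 6 * (6 * dd * M * D) * s := by
    have : 0 ≤ dd := by linarith
    positivity
  rw [div_le_iff₀ hM0]
  have e : 4 * G * M ^ 2 * b₁ * (D + (16384 * D * s + 2048 * (6 * dd * M * D) * D + 6 * (6 * dd * M * D) * s))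
      = (4 * G * (M * b₁)) * (D + (16384 * D * s + 2048 * (6 * dd * M * D) * D + 6 * (6 * dd * M * D) * s)) * M := by ring
  rw [e]
  have hsum : D + (16384 * D * s + 2048 * (6 * dd * M * D) * D + 6 * (6 * dd * M * D) * s) ≤ 2 * D := by linarith
  have hsum0 : 0 ≤ D + (16384 * D * s + 2048 * (6 * dd * M * D) * D + 6 * (6 * dd * M * D) * s) := by linarith
  have := mul_le_mul hβ hsum hsum0 hω0
  exact mul_le_mul_of_nonneg_right (by linarith [this]) hM0.le

include hdd hM hs hD hτ0 h1 h2 h3 hτs hω0 hβ in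
/-- **`ẽ_c∕M ≤ 24576·d·(τ + ω)·Df`**, `ẽ_c = 4096ση + E`. [folklore] -/
theorem ecM_le_nl :
    (4096 * (6 * dd * M * D) * η + 4 * G * M ^ 2 * b₁ * (D + (16384 * D * s + 2048 * (6 * dd * M * D) * D + 6 * (6 * dd * M * D) * s))) / M
      ≤ 24576 * dd * (τ + ω) * D := by
  have hM0 : 0 < M := by linarith
  have hold := ecM_le hdd hM hD h3 (η := η)
  have hE := EM_le hdd hM hs hD hτ0 h1 h2 hτs hω0 hβ
  rw [add_div]
  have h2ω : 2 * ω * D ≤ 24576 * dd * ω * D := by nlinarith [mul_nonneg hω0 hD]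
  nlinarith [hold, hE, h2ω]

include hM hsC hθc in
/-- the `E`-part of `ẽ_E`: `supC∕(M(1−θc))·2E ≤ 8·supC·ω·Df` whenever `E∕M ≤ 2ω·Df`. [folklore] -/
theorem extra_eE_le {E : ℝ} (hE0 : 0 ≤ E) (hE : E / M ≤ 2 * ω * D) : sC / (M * (1 - θc)) * (2 * E) ≤ 8 * sC * ω * D := by
  have hM0 : 0 < M := by linarith
  have h1θ : 1 / 2 ≤ 1 - θc := by linarith
  have hle : sC / (M * (1 - θc)) ≤ 2 * sC / M := by
    rw [div_le_div_iff₀ (by positivity) (by positivity)]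
    nlinarith [mul_nonneg hsC hM0.le]
  have hEM : E ≤ 2 * ω * D * M := by rwa [div_le_iff₀ hM0] at hE
  calc sC / (M * (1 - θc)) * (2 * E) ≤ 2 * sC / M * (2 * (2 * ω * D * M)) := by
        apply mul_le_mul hle (by linarith) (by positivity) (by positivity)
    _ = 8 * sC * ω * D := by field_simp; ring

include hM hK hsCC hθc in
/-- the `E`-part of `2KM·c̃_E`: `2KM·supCurlC∕(M²(1−θc))·2E ≤ 16·K·supCurlC·ω·Df` whenever `E∕M ≤ 2ω·Df`. [folklore] -/
theorem extra_cE_le {E : ℝ} (hE0 : 0 ≤ E) (hE : E / M ≤ 2 * ω * D) : 2 * K * M * (sCC / (M ^ 2 * (1 - θc)) * (2 * E)) ≤ 16 * K * sCC * ω * D := by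
  have hM0 : 0 < M := by linarith
  have h1θ : 1 / 2 ≤ 1 - θc := by linarith
  have hle : sCC / (M ^ 2 * (1 - θc)) ≤ 2 * sCC / M ^ 2 := by
    rw [div_le_div_iff₀ (by positivity) (by positivity)]
    nlinarith [mul_nonneg hsCC (by positivity : (0:ℝ) ≤ M ^ 2)]
  have hEM : E ≤ 2 * ω * D * M := by rwa [div_le_iff₀ hM0] at hE
  calc 2 * K * M * (sCC / (M ^ 2 * (1 - θc)) * (2 * E)) ≤ 2 * K * M * (2 * sCC / M ^ 2 * (2 * (2 * ω * D * M))) := by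
        apply mul_le_mul_of_nonneg_left _ (by positivity)
        exact mul_le_mul hle (by linarith) (by positivity) (by positivity)
    _ = 16 * K * sCC * ω * D := by field_simp; ring

include hdd hM hsC hs hη hD hθc hτ0 h1 h2 h3 hτs hG hb₁ hω0 hβ in
/-- **`ẽ_E ≤ 10⁶·(1+supC)·d²·(τ + ω)·Df`** at the floor `ẽ_E = e_J + supC∕(M(1−θc))·ẽ_φ`, `ẽ_φ = (3+12d)M·e_J + 2ẽ_c`. [folklore] -/
theorem eE_le_nl :
    (16384 * D * s + 2048 * (6 * dd * M * D) * D + 6 * (6 * dd * M * D) * s)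
      + sC / (M * (1 - θc)) * ((3 + 12 * dd) * M * (16384 * D * s + 2048 * (6 * dd * M * D) * D + 6 * (6 * dd * M * D) * s)
        + 2 * (4096 * (6 * dd * M * D) * η + 4 * G * M ^ 2 * b₁ * (D + (16384 * D * s + 2048 * (6 * dd * M * D) * D + 6 * (6 * dd * M * D) * s))))
    ≤ 1000000 * (1 + sC) * dd ^ 2 * (τ + ω) * D := by
  have hold := eE_le hdd hM hsC hs hη hD hθc hτ0 h1 h2 h3 (η := η)
  have hE := EM_le hdd hM hs hD hτ0 h1 h2 hτs hω0 hβ (G := G) (b₁ := b₁)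
  have hE0 : 0 ≤ 4 * G * M ^ 2 * b₁ * (D + (16384 * D * s + 2048 * (6 * dd * M * D) * D + 6 * (6 * dd * M * D) * s)) := by
    have : 0 ≤ dd := by linarith
    positivity
  have hextra := extra_eE_le hM hsC hθc hE0 hE
  have esplit : sC / (M * (1 - θc)) * ((3 + 12 * dd) * M * (16384 * D * s + 2048 * (6 * dd * M * D) * D + 6 * (6 * dd * M * D) * s)
        + 2 * (4096 * (6 * dd * M * D) * η + 4 * G * M ^ 2 * b₁ * (D + (16384 * D * s + 2048 * (6 * dd * M * D) * D + 6 * (6 * dd * M * D) * s))))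
      = sC / (M * (1 - θc)) * ((3 + 12 * dd) * M * (16384 * D * s + 2048 * (6 * dd * M * D) * D + 6 * (6 * dd * M * D) * s) + 2 * (4096 * (6 * dd * M * D) * η))
        + sC / (M * (1 - θc)) * (2 * (4 * G * M ^ 2 * b₁ * (D + (16384 * D * s + 2048 * (6 * dd * M * D) * D + 6 * (6 * dd * M * D) * s)))) := by ring
  rw [esplit]
  have hωD : 0 ≤ ω * D := mul_nonneg hω0 hD
  have hdd2 : (1 : ℝ) ≤ dd ^ 2 := by nlinarith
  have hr1 : 8 * sC * ω * D ≤ 1000000 * (1 + sC) * (ω * D) := by nlinarith [mul_nonneg hsC hωD, hωD]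
  have hr2 : 1000000 * (1 + sC) * (ω * D) ≤ 1000000 * (1 + sC) * (ω * D) * dd ^ 2 := le_mul_of_one_le_right (by positivity) hdd2
  have etot : 1000000 * (1 + sC) * dd ^ 2 * (τ + ω) * D = 1000000 * (1 + sC) * dd ^ 2 * τ * D + 1000000 * (1 + sC) * (ω * D) * dd ^ 2 := by ring
  rw [etot]
  linarith only [hold, hextra, hr1, hr2]

include hdd hM hK hsCC hs hη hD hθc hτ0 h1 h2 h3 h4 h5 hτs hG hb₁ hω0 hβ in
/-- **`2KM·c̃_E ≤ 2·10⁶·K(1+supCurlC)·d²·(τ + ω)·Df`** at the floor `c̃_E = c_J + supCurlC∕(M²(1−θc))·ẽ_φ`. [folklore] -/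
theorem twoKM_cE_le_nl :
    2 * K * M * ((2 * (2 * (6 * dd * M * D)) * x' + 4 * (Real.exp (4 * (s + D + (16384 * D * s + 2048 * (6 * dd * M * D) * D + 6 * (6 * dd * M * D) * s))) - 1)
        * (D + (16384 * D * s + 2048 * (6 * dd * M * D) * D + 6 * (6 * dd * M * D) * s)) + 2 * x * (6 * dd * M * D))
      + sCC / (M ^ 2 * (1 - θc)) * ((3 + 12 * dd) * M * (16384 * D * s + 2048 * (6 * dd * M * D) * D + 6 * (6 * dd * M * D) * s)
        + 2 * (4096 * (6 * dd * M * D) * η + 4 * G * M ^ 2 * b₁ * (D + (16384 * D * s + 2048 * (6 * dd * M * D) * D + 6 * (6 * dd * M * D) * s)))))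
      ≤ 2000000 * K * (1 + sCC) * dd ^ 2 * (τ + ω) * D := by
  have hold := twoKM_cE_le hdd hM hK hsCC hs hη hD hθc hτ0 h1 h2 h3 h4 h5 hτs (η := η)
  have hE := EM_le hdd hM hs hD hτ0 h1 h2 hτs hω0 hβ (G := G) (b₁ := b₁)
  have hE0 : 0 ≤ 4 * G * M ^ 2 * b₁ * (D + (16384 * D * s + 2048 * (6 * dd * M * D) * D + 6 * (6 * dd * M * D) * s)) := by
    have : 0 ≤ dd := by linarith
    positivity
  have hextra := extra_cE_le hM hK hsCC hθc hE0 hE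
  -- abstract the exponential atom before the algebra
  obtain ⟨Q, hQ⟩ : ∃ Q : ℝ, Real.exp (4 * (s + D + (16384 * D * s + 2048 * (6 * dd * M * D) * D + 6 * (6 * dd * M * D) * s))) - 1 = Q := ⟨_, rfl⟩
  rw [hQ] at hold ⊢
  have esplit : 2 * K * M * ((2 * (2 * (6 * dd * M * D)) * x' + 4 * Q * (D + (16384 * D * s + 2048 * (6 * dd * M * D) * D + 6 * (6 * dd * M * D) * s)) + 2 * x * (6 * dd * M * D))
      + sCC / (M ^ 2 * (1 - θc)) * ((3 + 12 * dd) * M * (16384 * D * s + 2048 * (6 * dd * M * D) * D + 6 * (6 * dd * M * D) * s)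
        + 2 * (4096 * (6 * dd * M * D) * η + 4 * G * M ^ 2 * b₁ * (D + (16384 * D * s + 2048 * (6 * dd * M * D) * D + 6 * (6 * dd * M * D) * s)))))
      = 2 * K * M * ((2 * (2 * (6 * dd * M * D)) * x' + 4 * Q * (D + (16384 * D * s + 2048 * (6 * dd * M * D) * D + 6 * (6 * dd * M * D) * s)) + 2 * x * (6 * dd * M * D))
        + sCC / (M ^ 2 * (1 - θc)) * ((3 + 12 * dd) * M * (16384 * D * s + 2048 * (6 * dd * M * D) * D + 6 * (6 * dd * M * D) * s) + 2 * (4096 * (6 * dd * M * D) * η)))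
        + 2 * K * M * (sCC / (M ^ 2 * (1 - θc)) * (2 * (4 * G * M ^ 2 * b₁ * (D + (16384 * D * s + 2048 * (6 * dd * M * D) * D + 6 * (6 * dd * M * D) * s))))) := by ring
  rw [esplit]
  have hωD : 0 ≤ ω * D := mul_nonneg hω0 hD
  have hdd2 : (1 : ℝ) ≤ dd ^ 2 := by nlinarith
  have hKs : 0 ≤ K * sCC * (ω * D) := mul_nonneg (mul_nonneg hK hsCC) hωD
  have hK1 : 0 ≤ K * (ω * D) := mul_nonneg hK hωD
  have hr1 : 16 * K * sCC * ω * D ≤ 2000000 * K * (1 + sCC) * (ω * D) := by nlinarith [hKs, hK1]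
  have hr2 : 2000000 * K * (1 + sCC) * (ω * D) ≤ 2000000 * K * (1 + sCC) * (ω * D) * dd ^ 2 := le_mul_of_one_le_right (by positivity) hdd2
  have etot : 2000000 * K * (1 + sCC) * dd ^ 2 * (τ + ω) * D = 2000000 * K * (1 + sCC) * dd ^ 2 * τ * D + 2000000 * K * (1 + sCC) * (ω * D) * dd ^ 2 := by ring
  rw [etot]
  linarith only [hold, hextra, hr1, hr2]

end Arith

end Summit.QuantumFields.BalabanUV.T4Continuum.NE7SliceIterationContractionArithNL
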